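import Mathlib
import Literature.NumberTheory.GaloisRepresentations.GaloisRep
import Literature.NumberTheory.GaloisRepresentations.FrobeniusDensity
import Literature.NumberTheory.GaloisRepresentations.FrobeniusPlaces
import Literature.NumberTheory.Automorphic.GaloisActionPlaces
import Literature.NumberTheory.Automorphic.ReciprocityGLnProofs
import Literature.NumberTheory.Automorphic.ReciprocityGLnRestrictionProofs
import Literature.NumberTheory.Automorphic.AsaiSign
import Literature.NumberTheory.Automorphic.BaseChangeUnramifiedLift
import Literature.NumberTheory.Automorphic.ChebotarevArtinRepHolds
import Literature.NumberTheory.Automorphic.SatakeParamNeZeroProofs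
import Literature.NumberTheory.Automorphic.TunnellOctahedralGlobal
import Literature.NumberTheory.Automorphic.TunnellOctahedralLocal
import Summits.Langlands.Langlands.Theorems.PicardMuOrdinaryMuOrdinaryFamilyRTDictionary
import Summits.Langlands.Langlands.Theorems.PicardMuOrdinaryMuOrdinaryFamilyRTQuadraticDescentClifford
import HarnessLib

/-!
# Base change of a polarized tower along a quadratic extension: the proved bookkeeping

Support file for stub `stub_baseChangeToL` of the line `split-ramified-prime-sqrt6` (crux
`Summit.Langlands.Langlands.Theses.PicardMuOrdinary.IrregularClassicality`, stmt-Langlands-13758).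
For a quadratic extension `E/F` of number fields and automorphisms `c ∈ Aut(E/ℚ)`, `c₀ ∈ Aut(F/ℚ)`
with `c|_F = c₀`, everything below is PROVED:

* places: `(c • w) ∩ 𝓞 F = c₀ • (w ∩ 𝓞 F)`, `N(c • w) = N w`, `f(c • w | c₀ • v) = f(w | v)`;
* **sup-norm from Frobenius congruences**: if `‖tr r(Frob⁻¹) - tr ρ(Frob⁻¹)‖ ≤ ε` at every
  arithmetic Frobenius off a finite set of places, then `‖tr r - tr ρ‖ ≤ ε` on all of `Γ_F`
  (Chebotarev density of Frobenii, `absoluteGaloisGroup.frobenius_dense` fed with the proved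
  `chebotarev_artinRep_holds`, and continuity of traces);
* the geometric-Frobenius trace `tr r(Frob_v⁻¹) = ι⁻¹(N v · Σ α)` of a representation compatible
  with `π` at `v` (sibling crux 13757, `trace_inv_of_charpoly_eq_arithFrobPolyOfSatake`);
* **cuspidality input** for Arthur–Clozel III.4.2 (a) in odd rank: an inert place `v` of `E/F`
  (Chebotarev, `frequently_quadraticSign_eq_neg_one`) where `π` is unramified, and `-α ≠ α` for its
  Satake parameter (`∏ α ≠ 0`, `hasSatakeParamAt_ne_zero_holds`);
* **conjugate self-duality ascends** along an unramified strong base-change lift: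
  `Sat(Π, c • w) = Sat(π, c₀ • v)^f = (Sat(π, v)⁻¹)^f = Sat(Π, w)⁻¹` almost everywhere.
-/

open scoped MatrixGroups Classical
open IsDedekindDomain NumberField Polynomial Filter
open Literature.NumberTheory.GaloisRepresentations Literature.NumberTheory.Automorphic

set_option linter.dupNamespace false -- project-wide: `Summit.Langlands.Langlands` is the mandated namespace

noncomputable section

namespace Summit.Langlands.Langlands.Theorems.IrregularClassicality.SplitRamifiedPrimeSqrt6

/-! ## Places: conjugate places under compatible automorphisms -/

section Places

variable {F E : Type*} [Field F] [NumberField F] [Field E] [NumberField E] [Algebra F E]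

/-- **Compatible automorphisms move the place below along**: if `σ ∈ Aut(E/ℚ)` restricts to
`σ₀ ∈ Aut(F/ℚ)` on `F`, then `(σ • w) ∩ 𝓞 F = σ₀ • (w ∩ 𝓞 F)`. -/
theorem under_smul_eq_smul_under (σ : E ≃ₐ[ℚ] E) (σ₀ : F ≃ₐ[ℚ] F)
    (h : ∀ x : F, σ (algebraMap F E x) = algebraMap F E (σ₀ x)) (w : HeightOneSpectrum (𝓞 E)) :
    (σ • w).under (𝓞 F) = σ₀ • w.under (𝓞 F) := by
  have h' : ∀ x : F, σ⁻¹ (algebraMap F E x) = algebraMap F E (σ₀⁻¹ x) := fun x => by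
    rw [AlgEquiv.aut_inv, AlgEquiv.aut_inv, AlgEquiv.symm_apply_eq, h, AlgEquiv.apply_symm_apply]
  apply HeightOneSpectrum.ext
  rw [HeightOneSpectrum.under_asIdeal]
  ext y
  rw [Ideal.under, Ideal.mem_comap, HeightOneSpectrum.smul_asIdeal, HeightOneSpectrum.smul_asIdeal,
    Ideal.mem_pointwise_smul_iff_inv_smul_mem, Ideal.mem_pointwise_smul_iff_inv_smul_mem,
    HeightOneSpectrum.under_asIdeal, Ideal.under, Ideal.mem_comap]
  have key : σ⁻¹ • algebraMap (𝓞 F) (𝓞 E) y = algebraMap (𝓞 F) (𝓞 E) (σ₀⁻¹ • y) :=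
    RingOfIntegers.ext (h' y)
  rw [key]

/-- Conjugate places have the same residue cardinality. -/
theorem residueCard_smul (σ : E ≃ₐ[ℚ] E) (w : HeightOneSpectrum (𝓞 E)) :
    (σ • w).residueCard = w.residueCard := by
  unfold HeightOneSpectrum.residueCard
  exact HeightOneSpectrum.absNorm_algEquiv_smul ℚ σ w

/-- **Compatible automorphisms preserve residue degrees**: `f(σ • w | σ₀ • v) = f(w | v)`
(`N w = N v ^ f` on both sides, `N v > 1`). -/
theorem inertiaDeg_smul_eq (σ : E ≃ₐ[ℚ] E) (σ₀ : F ≃ₐ[ℚ] F)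
    (h : ∀ x : F, σ (algebraMap F E x) = algebraMap F E (σ₀ x)) (w : HeightOneSpectrum (𝓞 E)) :
    (σ • w).asIdeal.inertiaDeg (𝓞 F) = w.asIdeal.inertiaDeg (𝓞 F) := by
  have h1 := residueCard_eq_residueCard_pow_inertiaDeg (v := w.under (𝓞 F)) (w := w) rfl
  have h2 := residueCard_eq_residueCard_pow_inertiaDeg (v := (σ • w).under (𝓞 F)) (w := σ • w) rfl
  rw [residueCard_smul, under_smul_eq_smul_under σ σ₀ h, residueCard_smul, h1] at h2
  exact (Nat.pow_right_injective (HeightOneSpectrum.one_lt_residueCard _) h2).symm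

end Places

/-! ## Sup-norm bounds on `Γ_F` from bounds at the Frobenii -/

section Density

variable {F : Type} [Field F] [NumberField F] {A : Type*} [NormedCommRing A] {n : ℕ}

/-- **A trace congruence at the Frobenii off a finite set holds on all of `Γ_F`.**  If
`‖tr r(σ⁻¹) - tr ρ(σ⁻¹)‖ ≤ ε` for every arithmetic Frobenius `σ` at every prime over a place
`v ∉ S` (`S` finite), then `‖tr r(g) - tr ρ(g)‖ ≤ ε` for every `g ∈ Γ_F`: these Frobenii are dense
(Chebotarev: `absoluteGaloisGroup.frobenius_dense`, `chebotarev_artinRep_holds`) and the condition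
is closed (`FramedRep.continuous_trace`). -/
theorem norm_trace_sub_le_of_frobenius (S : Set (HeightOneSpectrum (𝓞 F))) (hS : S.Finite)
    (r ρ : FramedGaloisRep F A n) (ε : ℝ)
    (h : ∀ v ∉ S, ∀ 𝔓 ∈ v.primesAbove, ∀ σ : Field.absoluteGaloisGroup F,
      IsArithFrobAt (𝓞 F) σ 𝔓 → ‖FramedRep.trace r σ⁻¹ - FramedRep.trace ρ σ⁻¹‖ ≤ ε)
    (g : Field.absoluteGaloisGroup F) : ‖FramedRep.trace r g - FramedRep.trace ρ g‖ ≤ ε := by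
  have hD := absoluteGaloisGroup.frobenius_dense chebotarev_artinRep_holds F S hS
  have hC : IsClosed {g : Field.absoluteGaloisGroup F |
      ‖FramedRep.trace r g⁻¹ - FramedRep.trace ρ g⁻¹‖ ≤ ε} := by
    refine isClosed_le ?_ continuous_const
    exact (((FramedRep.continuous_trace r).comp continuous_inv).sub
      ((FramedRep.continuous_trace ρ).comp continuous_inv)).norm
  have hsub : {σ : Field.absoluteGaloisGroup F |
      ∃ v ∉ S, ∃ 𝔓 ∈ v.primesAbove, IsArithFrobAt (𝓞 F) σ 𝔓} ⊆
      {g | ‖FramedRep.trace r g⁻¹ - FramedRep.trace ρ g⁻¹‖ ≤ ε} := by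
    rintro σ ⟨v, hv, 𝔓, h𝔓, hσ⟩
    exact h v hv 𝔓 h𝔓 σ hσ
  have huniv := hC.closure_subset_iff.mpr hsub
  rw [hD.closure_eq] at huniv
  have hg := huniv (Set.mem_univ g⁻¹)
  simpa only [Set.mem_setOf_eq, inv_inv] using hg

end Density

/-! ## Automorphic bookkeeping -/

section Automorphic

variable {F : Type} [Field F] [NumberField F] {E : Type} [Field E] [NumberField E] [Algebra F E]

/-- **The trace of a geometric Frobenius** of a representation compatible with `π` at `v`
(`IsGaloisCompatibleAt`, Satake parameter `α`): `tr r(σ⁻¹) = ι⁻¹(N v · Σ α)` for every arithmetic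
Frobenius `σ` at a prime over `v` (the arithmetic Frobenius has characteristic polynomial
`∏ (X - ι⁻¹((N v · a)⁻¹))`; sibling crux 13757's `trace_inv_of_charpoly_eq_arithFrobPolyOfSatake`). -/
theorem trace_inv_eq_of_isGaloisCompatibleAt (ι : PadicAlgCl 3 ≃+* ℂ)
    {hF : isCompact_glFiniteIntegralLevel 3 F} {π : AutomorphicRepData (AutomorphyDatum.gl 3 F hF)}
    {r : FramedGaloisRep F (PadicAlgCl 3) 3} {v : HeightOneSpectrum (𝓞 F)}
    (hc : IsGaloisCompatibleAt π ι r v) {α : Multiset ℂ} (hα : π.HasSatakeParamAt v α)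
    {𝔓 : Ideal (absIntegers (𝓞 F) F)} (h𝔓 : 𝔓 ∈ v.primesAbove) {σ : Field.absoluteGaloisGroup F}
    (hσ : IsArithFrobAt (𝓞 F) σ 𝔓) :
    FramedRep.trace r σ⁻¹ = ι.symm ((v.residueCard : ℂ) * α.sum) := by
  obtain ⟨-, hch⟩ := hc α hα
  unfold FramedRep.trace
  rw [map_inv]
  exact Cruxes.MuOrdinaryFamilyRT.CharZeroDominance.trace_inv_of_charpoly_eq_arithFrobPolyOfSatake ι
    v.residueCard α (r σ) (hch 𝔓 h𝔓 σ hσ)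

/-- **`-α ≠ α` for a Satake parameter in odd rank** (more generally for the primitive square root
of unity `ζ = -1`): otherwise `∏ α = -∏ α`, so some Satake eigenvalue vanishes, contradicting
`hasSatakeParamAt_ne_zero_holds`.  This is the hypothesis "`π ≇ π ⊗ η_{E/F}`" of Arthur–Clozel's
Thm. III.4.2 (a) in the quadratic case. -/
theorem map_mul_ne_of_hasSatakeParamAt {n : ℕ} (hn : Odd n) {hF : isCompact_glFiniteIntegralLevel n F}
    {π : AutomorphicRepData (AutomorphyDatum.gl n F hF)} {v : HeightOneSpectrum (𝓞 F)}
    {α : Multiset ℂ} (hα : π.HasSatakeParamAt v α) {ζ : ℂ} (hζ : IsPrimitiveRoot ζ 2) :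
    α.map (ζ * ·) ≠ α := by
  rw [hζ.eq_neg_one_of_two_right]
  intro heq
  have hprod := congrArg Multiset.prod heq
  rw [Multiset.prod_map_mul, Multiset.map_const', Multiset.prod_replicate, Multiset.map_id',
    hα.card_eq, hn.neg_one_pow, neg_one_mul] at hprod
  have h0 : α.prod = 0 := by linear_combination (-(1 : ℂ) / 2) * hprod
  exact hasSatakeParamAt_ne_zero_holds hα 0 (Multiset.prod_eq_zero_iff.mp h0) rfl

/-- **An inert good place** for a quadratic `E/F` and an automorphic `π` of odd rank: a place `v`
of `F` inert in `E` (a place `w ∣ v` of residue degree `2 = [E : F]`; infinitely many exist by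
Chebotarev, `frequently_quadraticSign_eq_neg_one`) at which `π` is unramified (almost all places,
`hasSatakeParamAt_cofinite_holds`), with the non-twist condition of `baseChange_cyclic_cuspidal`. -/
theorem exists_inert_hasSatakeParamAt (h2 : Module.finrank F E = 2) {n : ℕ} (hn : Odd n)
    {hF : isCompact_glFiniteIntegralLevel n F} (π : AutomorphicRepData (AutomorphyDatum.gl n F hF)) :
    ∃ (v : HeightOneSpectrum (𝓞 F)) (w : HeightOneSpectrum (𝓞 E)) (α : Multiset ℂ),
      w.asIdeal.under (𝓞 F) = v.asIdeal ∧ w.asIdeal.inertiaDeg (𝓞 F) = Module.finrank F E ∧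
      π.HasSatakeParamAt v α ∧
      ∀ ζ : ℂ, IsPrimitiveRoot ζ (Module.finrank F E) → α.map (ζ * ·) ≠ α := by
  obtain ⟨v, hεv, α, hα⟩ :=
    ((Cruxes.MuOrdinaryFamilyRT.CharZeroDominance.frequently_quadraticSign_eq_neg_one
      (L := F) (E := E) h2).and_eventually π.hasSatakeParamAt_cofinite_holds).exists
  obtain ⟨w, hw⟩ := exists_above (E := E) v
  have hf : w.asIdeal.inertiaDeg (𝓞 F) = 2 := by
    unfold quadraticSign at hεv
    split_ifs at hεv with hex
    · norm_num at hεv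
    · push Not at hex
      rcases inertiaDeg_eq_one_or_two_of_finrank_eq_two h2 v w hw with h | h
      · exact absurd h (hex w hw)
      · exact h
  refine ⟨v, w, α, hw, by rw [hf, h2], hα, fun ζ hζ => ?_⟩
  rw [h2] at hζ
  exact map_mul_ne_of_hasSatakeParamAt hn hα hζ

/-- **Conjugate self-duality ascends along an unramified strong base-change lift.**  If `Π` on
`GL_n(𝔸_E)` is an unramified strong lift of `π` on `GL_n(𝔸_F)` (`IsUnramifiedBaseChangeLift`:
`Sat(Π, w) = Sat(π, v)^{f(w|v)}` at every `w` over an unramified `v`), `c ∈ Aut(E/ℚ)` restricts to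
`c₀` on `F`, and `π` is conjugate self-dual for `c₀` almost everywhere, then `Π` is conjugate
self-dual for `c`: at almost every `w` (over `v`),
`Sat(Π, c • w) = Sat(π, c₀ • v)^{f(c•w|c₀•v)} = (Sat(π, v)⁻¹)^{f(w|v)} = Sat(Π, w)⁻¹`. -/
theorem isConjSelfDualAE_of_isUnramifiedBaseChangeLift {n : ℕ}
    {hF : isCompact_glFiniteIntegralLevel n F} {hE : isCompact_glFiniteIntegralLevel n E}
    {π : AutomorphicRepData (AutomorphyDatum.gl n F hF)}
    {P : AutomorphicRepData (AutomorphyDatum.gl n E hE)} (hU : IsUnramifiedBaseChangeLift π P)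
    {c : E ≃ₐ[ℚ] E} {c₀ : F ≃ₐ[ℚ] F} (hcc₀ : ∀ x : F, c (algebraMap F E x) = algebraMap F E (c₀ x))
    (hπ : π.IsConjSelfDualAE c₀) : P.IsConjSelfDualAE c := by
  have hunr : ∀ᶠ v : HeightOneSpectrum (𝓞 F) in cofinite, Algebra.IsUnramifiedIn (𝓞 E) v.asIdeal := by
    rw [eventually_cofinite]
    exact finite_setOf_not_isUnramifiedIn F E
  have hπu : ∀ᶠ v : HeightOneSpectrum (𝓞 F) in cofinite, π.IsUnramifiedAt v :=
    π.hasSatakeParamAt_cofinite_holds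
  have hinj : Tendsto (fun v : HeightOneSpectrum (𝓞 F) => c₀ • v) cofinite cofinite :=
    (MulAction.injective c₀).tendsto_cofinite
  have hall := (hunr.and hπu).and ((hinj.eventually (hunr.and hπu)).and hπ)
  refine ((tendsto_under_cofinite (𝓞 F)).eventually hall).mono fun w hw α β hα hβ => ?_
  obtain ⟨⟨hvu, γ, hγ⟩, ⟨hcvu, δ, hδ⟩, hcsd⟩ := hw
  have hδγ : δ = γ.map (·⁻¹) := hcsd γ δ hγ hδ
  have h1 : P.HasSatakeParamAt w (γ.map (· ^ w.asIdeal.inertiaDeg (𝓞 F))) :=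
    hU w (w.under (𝓞 F)) γ rfl hvu hγ
  have hcw : (c • w).asIdeal.under (𝓞 F) = (c₀ • w.under (𝓞 F)).asIdeal := by
    rw [← HeightOneSpectrum.under_asIdeal, under_smul_eq_smul_under c c₀ hcc₀ w]
  have h2 := hU (c • w) (c₀ • w.under (𝓞 F)) δ hcw hcvu hδ
  rw [inertiaDeg_smul_eq c c₀ hcc₀ w, hδγ, Multiset.map_map] at h2
  obtain rfl := P.hasSatakeParamAt_unique_holds hα h1
  obtain rfl := P.hasSatakeParamAt_unique_holds hβ h2
  rw [Multiset.map_map]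
  exact Multiset.map_congr rfl fun a _ => by simp only [Function.comp_apply, inv_pow]

/-- **Conjugate self-duality ascends along an unramified strong base-change lift** (registered
sub-goal form of `isConjSelfDualAE_of_isUnramifiedBaseChangeLift`). -/
theorem isConjSelfDualAE_baseChange : ∀ {F : Type} [Field F] [NumberField F] {E : Type} [Field E] [NumberField E] [Algebra F E] {n : ℕ} {hF : isCompact_glFiniteIntegralLevel n F} {hE : isCompact_glFiniteIntegralLevel n E} {π : AutomorphicRepData (AutomorphyDatum.gl n F hF)} {P : AutomorphicRepData (AutomorphyDatum.gl n E hE)}, IsUnramifiedBaseChangeLift π P → ∀ {c : E ≃ₐ[ℚ] E} {c₀ : F ≃ₐ[ℚ] F}, (∀ x : F, c (algebraMap F E x) = algebraMap F E (c₀ x)) → π.IsConjSelfDualAE c₀ → P.IsConjSelfDualAE c :=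
  fun hU _ _ hcc₀ hπ => isConjSelfDualAE_of_isUnramifiedBaseChangeLift hU hcc₀ hπ

end Automorphic

end Summit.Langlands.Langlands.Theorems.IrregularClassicality.SplitRamifiedPrimeSqrt6

end
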